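import Summits.NavierStokesRegularity.NavierStokesRegularity.Theorems.RecurrentProfilesRecurrentLiouvilleFrFastRecurrenceRemoval
import HarnessLib

/-!
# Crux `ForcedSymmetry` (stmt-NavierStokesRegularity-4052), line `closing-dichotomy` — fast almost-periodicity removal

Support file (`--supports stmt-NavierStokesRegularity-4052`; lead c9).  Sub-rung (a) of the registered wall
`stub_almostPeriodicLiouville` of `Cruxes/ForcedSymmetry/Lines/closing_dichotomy.lean` (gen c9.1), as named by the
line card `Lines/closing-dichotomy.md` and the strategy census v3 §R10(3): FAST almost periodicity of the scaling
orbit is removable.  In the almost-periodic branch of the line the profile `u` satisfies, for every accuracy `ε` and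
compact `K ⊆ {t ≤ 0} × ℝ³`, that the log-scales `σ` with `sup_s ‖(u_{e^s})_{e^σ} − u_{e^s}‖_{L³(K)} ≤ ε` (almost
periods of the WHOLE orbit) are relatively dense with some inclusion length `L(ε, K)`.  The theorems below settle
every such profile whose inclusion length at the class thresholds is short: there are `L(C,M) > 0`, `δ(C,M) > 0`
such that almost periods of accuracy `δ` on the box `[-1,0] × B̄₁` in every window of length `L` force regularity
at the origin — because an almost period of the orbit is in particular (log-time `s = 0`) a return of the base
point, and fast RECURRENCE is removable by the tree's `fr_fastRecurrenceRemoval_compact` (crux 1589, line `Sketch`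
v7: class-uniform orbit modulus + `smallHullRemoval`).  So the open content of `stub_almostPeriodicLiouville` is the
SLOW regime (inclusion lengths `L(δ(C,M), box) > L(C,M)`), the exact analogue of `l ≥ λ_*` for `λ`-DSS profiles.

* `fastApRemoval_box` — the removal statement with the class thresholds.
* `apSlow_of_singular` — portrait clause: a singular class profile has a window of length `L(C,M)` free of
  `δ(C,M)`-almost periods of its orbit (some log-time `s` separates), the contrapositive.

## References

* D. Chae, J. Wolf, arXiv:1610.09464, Thm 1.3 (the near-identity DSS rung this generalises). [ChaeWolf2017RemovingDSS]
* T.-P. Tsai, Arch. Rational Mech. Anal. 143 (1998), Thm 1. [Tsai1998]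
* D. Albritton, T. Barker, J. Math. Fluid Mech. 21 (2019), Lemma 2.2, Prop. 2.3. [AlbrittonBarker2019]
* H. Bohr, *Almost Periodic Functions* (1947), §§44–46 (almost periods, inclusion length). [folklore]
-/

noncomputable section

-- the sub-problem namespace repeats the summit name (D-0017 layout `Summit.<S>.<P>.Theorems`)
set_option linter.dupNamespace false

namespace Summit.NavierStokesRegularity.NavierStokesRegularity.Theorems

open MeasureTheory Set Function Filter Topology TopologicalSpace Metric
open Literature.Analysis Literature.Analysis.FluidPDE
open scoped NNReal ENNReal

/-- **Fast almost-periodicity removal** (sub-rung (a) of `stub_almostPeriodicLiouville`, line `closing-dichotomy`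
of crux stmt-NavierStokesRegularity-4052).  For every rate `C` and bound `M < ⊤` there are `L > 0`, `δ > 0` such
that a class member (suitable weak on `ℝ³ × ℝ₋`, weak gradient, `𝐈 ≤ M`, rate `C`) whose scaling orbit admits, in
every log-scale window `[a, a + L]`, a `δ`-almost period `σ` OF THE WHOLE ORBIT on the box `[-1,0] × B̄₁`
(`‖(u_{e^s})_{e^σ} − u_{e^s}‖_{L³} ≤ δ` for all `s`) is regular at the origin: at `s = 0` an almost period is a
return of `u` itself, and fast recurrence is removable (`fr_fastRecurrenceRemoval_compact`).
[cite: ChaeWolf2017RemovingDSS, Thm 1.3; Tsai1998, Thm 1; AlbrittonBarker2019, Lemma 2.2, Prop. 2.3] -/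
theorem fastApRemoval_box :
    ∀ (C : ℝ) (M : ℝ≥0∞), M < ⊤ → ∃ L : ℝ, 0 < L ∧ ∃ δ : ℝ, 0 < δ ∧
      ∀ (u : ℝ → EuclideanSpace ℝ (Fin 3) → EuclideanSpace ℝ (Fin 3))
        (p : ℝ → EuclideanSpace ℝ (Fin 3) → ℝ)
        (G : ℝ → EuclideanSpace ℝ (Fin 3) → EuclideanSpace ℝ (Fin 3) →L[ℝ] EuclideanSpace ℝ (Fin 3)),
        IsSuitableWeakSolutionOn (slab (EuclideanSpace ℝ (Fin 3)) (Iio 0) isOpen_Iio) 1 0 u p →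
        HasWeakSpatialGradientOn (slab (EuclideanSpace ℝ (Fin 3)) (Iio 0) isOpen_Iio) u G →
        typeIBound (Iio (0 : ℝ) ×ˢ univ) u p G ≤ M →
        HasTypeITimeDecay C u →
        (∀ a : ℝ, ∃ σ ∈ Icc a (a + L), ∀ s : ℝ,
          eLpNorm (fun z : ℝ × EuclideanSpace ℝ (Fin 3) =>
              nsRescale (Real.exp σ) (nsRescale (Real.exp s) u) z.1 z.2 - nsRescale (Real.exp s) u z.1 z.2) 3
            (volume.restrict (Icc (-1 : ℝ) 0 ×ˢ closedBall (0 : EuclideanSpace ℝ (Fin 3)) 1)) ≤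
              ENNReal.ofReal δ) →
        ¬ IsBackwardSingularPoint u 0 := by
  intro C M hM
  obtain ⟨L, hL, δ, hδ, hfast⟩ := fr_fastRecurrenceRemoval_compact C M hM
  refine ⟨L, hL, δ, hδ, fun u p G hsw hwg hI hdec hap => hfast u p G hsw hwg hI hdec fun a => ?_⟩
  obtain ⟨σ, hσ, hall⟩ := hap a
  refine ⟨σ, hσ, ?_⟩
  have h0 := hall 0
  simpa only [Real.exp_zero, nsRescale_one] using h0

/-- **Portrait clause: a singular almost-periodic orbit is SLOW.**  For every rate `C` and bound `M < ⊤` there are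
`L > 0`, `δ > 0` such that every origin-singular class member has a log-scale window `[a, a + L]` in which NO `σ` is
a `δ`-almost period of its whole orbit on the box `[-1,0] × B̄₁`: for each such `σ` some log-time `s` separates
(`‖(u_{e^s})_{e^σ} − u_{e^s}‖_{L³} > δ`).  Contrapositive of `fastApRemoval_box`; it is the clause the residual of
`stub_almostPeriodicLiouville` lives in. [cite: AlbrittonBarker2019, Prop. 2.3; Tsai1998, Thm 1] -/
theorem apSlow_of_singular :
    ∀ (C : ℝ) (M : ℝ≥0∞), M < ⊤ → ∃ L : ℝ, 0 < L ∧ ∃ δ : ℝ, 0 < δ ∧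
      ∀ (u : ℝ → EuclideanSpace ℝ (Fin 3) → EuclideanSpace ℝ (Fin 3))
        (p : ℝ → EuclideanSpace ℝ (Fin 3) → ℝ)
        (G : ℝ → EuclideanSpace ℝ (Fin 3) → EuclideanSpace ℝ (Fin 3) →L[ℝ] EuclideanSpace ℝ (Fin 3)),
        IsSuitableWeakSolutionOn (slab (EuclideanSpace ℝ (Fin 3)) (Iio 0) isOpen_Iio) 1 0 u p →
        HasWeakSpatialGradientOn (slab (EuclideanSpace ℝ (Fin 3)) (Iio 0) isOpen_Iio) u G →
        typeIBound (Iio (0 : ℝ) ×ˢ univ) u p G ≤ M →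
        HasTypeITimeDecay C u →
        IsBackwardSingularPoint u 0 →
        ∃ a : ℝ, ∀ σ ∈ Icc a (a + L), ∃ s : ℝ,
          ENNReal.ofReal δ <
            eLpNorm (fun z : ℝ × EuclideanSpace ℝ (Fin 3) =>
                nsRescale (Real.exp σ) (nsRescale (Real.exp s) u) z.1 z.2 - nsRescale (Real.exp s) u z.1 z.2) 3
              (volume.restrict (Icc (-1 : ℝ) 0 ×ˢ closedBall (0 : EuclideanSpace ℝ (Fin 3)) 1)) := by
  intro C M hM
  obtain ⟨L, hL, δ, hδ, hfast⟩ := fastApRemoval_box C M hM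
  refine ⟨L, hL, δ, hδ, fun u p G hsw hwg hI hdec hsing => ?_⟩
  by_contra h
  push Not at h
  exact hfast u p G hsw hwg hI hdec h hsing

end Summit.NavierStokesRegularity.NavierStokesRegularity.Theorems

end
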